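import Literature.Computability.AlgebraicComplexity.SubstitutionBacktracking
import HarnessLib

/-!
# Substitution with backtracking and weighted (LP) leaves

Topic `Literature/Computability/AlgebraicComplexity`. Everything here is PROVED for an arbitrary
bilinear map `φ : U × V → W` over a field; no named facts. A companion of
`SubstitutionBacktracking.lean` (Wang 2026, §6–§7: the DFS case analysis `NodeOK` / `BCert`) and
`SubstitutionLPBound.lean` (the weighted form of the substitution inequalities).

In Wang's DFS a node `s` of depth `d` (read: "the computation, its products sorted by candidate index,
has first `d` products with first forms proportional to `c_{s 0}, …, c_{s (d-1)}`") is closed by ONE set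
`F` of candidates when `#{p < d | c_{s p} killed by F} + LB F ≥ target` (`LeafOK`). Here a node may be
closed by a WEIGHTED FAMILY of sets — rows `(F_j, y_j)`, `j < L`, and a denominator `D` — under the
dual-feasibility condition restricted to the candidates that can still occur beyond the prefix
(`n ≥ s p` for all `p`): every product `i ≥ d` has such a candidate, so summing `y_j ·` (substitution
inequality for `F_j`) and exchanging sums gives

  `∑_j y_j · (LB F_j + k_j) + D·d ≤ d · ∑_j y_j + D · (number of products)`,
  `k_j := #{p < d | c_{s p} killed by F_j}`,

so the node is closed when `(target - 1)·D + d·∑_j y_j < ∑_j y_j·(LB F_j + k_j) + D·d`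
(`LPLeafOK`). With one row of weight `1` and `D = 1` this is literally `LeafOK`, so `NodeOKLP` is a
conservative generalisation of `NodeOK` (`nodeOKLP_of_nodeOK`). The file provides the Prop-level
rule (`LPLeafOK`, `NodeOKLP`), its soundness (`le_card_of_nodeOKLP_root`, same hypotheses as
`le_card_of_nodeOK_root`), and a concrete certificate tree `LPCert` with a Boolean replay `check` and
`le_card_of_checkLP_root`, so that a certificate checker can accept "LP leaves" by `decide`.

Which candidates a set `F` kills is a Boolean function `killB F n` supplied by the user together with
the soundness hypothesis `killB F n = true → c_n = 0 on S_F` (e.g. `n ∈ F`, or membership of `c_n` in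
the span of `K ∪ c[F]` decided by row reduction).

HONEST FRAMING: an elementary strengthening of the leaf rule of a published case analysis (weighted
sums of the same substitution inequalities; the linear-programming relaxation at each DFS node),
written as the soundness theorem of a certificate format; it proves no bound on any particular tensor.

## References

* C. Wang, *Automated Lower Bounds for Bilinear Complexity over Finite Fields*, arXiv:2603.07280
  (2026), §6 (Lemma 3; substitution with backtracking), §7 (certificates, replay). [Wang2026]
* M. Bläser, J. Complexity 19 (2003) 43–60, Def. 1 (bilinear computations). [Blaser2003]
-/

namespace Literature.Computability.AlgebraicComplexity

open Module

variable {k : Type*} [Field k]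
variable {U V W : Type*} [AddCommGroup U] [Module k U] [AddCommGroup V] [Module k V]
  [AddCommGroup W] [Module k W]

section LPBacktracking

variable {N : ℕ} (killB : Finset (Fin N) → Fin N → Bool) (LB : Finset (Fin N) → ℕ)
  (target maxDepth : ℕ)

/-- A DFS node `s` of depth `d` is **closed by an LP leaf**: rows `(F_j, y_j)_{j < L}` and a
denominator `D` with (i) dual feasibility for every candidate `n` above all entries of `s`:
`∑_{j : F_j does not kill n} y_j ≤ D`, and (ii) the closing inequality
`(target - 1)·D + d·∑_j y_j < ∑_j y_j·(LB F_j + #{p | F_j kills c_{s p}}) + D·d`.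
[cite: Wang2026, §6–§7 (substitution with backtracking; leaves)] -/
def LPLeafOK (d : ℕ) (s : Fin d → Fin N) : Prop :=
  ∃ (L : ℕ) (Fs : Fin L → Finset (Fin N)) (ys : Fin L → ℕ) (D : ℕ),
    (∀ n : Fin N, (∀ p : Fin d, s p ≤ n) →
        ∑ j ∈ Finset.univ.filter (fun j => killB (Fs j) n = false), ys j ≤ D) ∧
    (target - 1) * D + d * ∑ j, ys j <
        ∑ j, ys j * (LB (Fs j) + (Finset.univ.filter fun p => killB (Fs j) (s p) = true).card) + D * d

/-- **The node rule with LP leaves** (fuelled): a node is OK if it is closed by an LP leaf, or if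
`d < maxDepth` and all children `m ≥ s p` are OK. [cite: Wang2026, §6 (substitution with backtracking)] -/
def NodeOKLP : ℕ → (d : ℕ) → (Fin d → Fin N) → Prop
  | 0, d, s => LPLeafOK killB LB target d s
  | fuel + 1, d, s => LPLeafOK killB LB target d s ∨
      (d < maxDepth ∧
        ∀ m : Fin N, (∀ p : Fin d, s p ≤ m) → NodeOKLP fuel (d + 1) (Fin.snoc s m))

variable {killB LB target maxDepth}

/-- A single set `F` closing the node in Wang's sense (`target ≤ #{p | s p killed} + LB F`, with
"killed" read through `killB`) is an LP leaf with one row of weight `1` and `D = 1` (for a positive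
target; the strict "ceiling" form of the closing inequality is what makes `target = 0` special).
[cite: Wang2026, §7 (leaves of the backtracking certificate)] -/
theorem lpLeafOK_of_single {d : ℕ} {s : Fin d → Fin N} (F : Finset (Fin N)) (h0 : 0 < target)
    (h : target ≤ (Finset.univ.filter fun p => killB F (s p) = true).card + LB F) :
    LPLeafOK killB LB target d s := by
  refine ⟨1, fun _ => F, fun _ => 1, 1, fun n _ => ?_, ?_⟩
  · calc ∑ j ∈ Finset.univ.filter (fun j : Fin 1 => killB F n = false), (1 : ℕ)
        ≤ ∑ _j : Fin 1, (1 : ℕ) := Finset.sum_le_sum_of_subset (Finset.filter_subset _ _)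
      _ = 1 := by simp
  · rw [Fin.sum_univ_one, Fin.sum_univ_one]
    show (target - 1) * 1 + d * 1 <
      1 * (LB F + (Finset.univ.filter fun p => killB F (s p) = true).card) + 1 * d
    omega

/-- `NodeOK` (with leaves read through `killB F n := n ∈ F`) implies `NodeOKLP`: the weighted rule is
a conservative extension of Wang's. [cite: Wang2026, §6–§7 (substitution with backtracking)] -/
theorem nodeOKLP_of_nodeOK {LB : Finset (Fin N) → ℕ} {target maxDepth : ℕ} (h0 : 0 < target) :
    ∀ (fuel d : ℕ) (s : Fin d → Fin N), NodeOK LB target maxDepth fuel d s →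
      NodeOKLP (fun F n => decide (n ∈ F)) LB target maxDepth fuel d s
  | 0, d, s, h => by
    obtain ⟨F, hF⟩ := h
    exact lpLeafOK_of_single F h0 (by simpa using hF)
  | fuel + 1, d, s, h => by
    rcases h with ⟨F, hF⟩ | ⟨hd, hch⟩
    · exact Or.inl (lpLeafOK_of_single F h0 (by simpa using hF))
    · exact Or.inr ⟨hd, fun m hm => nodeOKLP_of_nodeOK h0 fuel (d + 1) _ (hch m hm)⟩

/-- `#{i : Fin r₀ | i < d} = d` for `d ≤ r₀` (the image of `Fin d`). [folklore] -/
private theorem lpAux_card_filter_lt {r₀ d : ℕ} (hd : d ≤ r₀) :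
    (Finset.univ.filter fun i : Fin r₀ => i.val < d).card = d := by
  have h : (Finset.univ : Finset (Fin d)).map (Fin.castLEEmb hd) =
      Finset.univ.filter fun i : Fin r₀ => i.val < d := by
    ext i
    simp only [Finset.mem_map, Finset.mem_univ, true_and, Finset.mem_filter]
    constructor
    · rintro ⟨p, rfl⟩
      simp [Fin.castLEEmb_apply]
    · intro hi
      exact ⟨⟨i.val, hi⟩, Fin.ext (by simp [Fin.castLEEmb_apply])⟩
  rw [← h, Finset.card_map]
  simp

/-- `#{i : Fin r₀ | d ≤ i} = r₀ - d` for `d ≤ r₀`. [folklore] -/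
private theorem lpAux_card_filter_ge {r₀ d : ℕ} (hd : d ≤ r₀) :
    (Finset.univ.filter fun i : Fin r₀ => d ≤ i.val).card = r₀ - d := by
  have h := Finset.card_filter_add_card_filter_not
    (s := (Finset.univ : Finset (Fin r₀))) (fun i => i.val < d)
  simp only [Finset.card_univ, Fintype.card_fin, not_lt] at h
  rw [lpAux_card_filter_lt hd] at h
  omega

/-! ### Soundness -/

variable {φ : U →ₗ[k] V →ₗ[k] W} {K : List (Dual k U)} {c : Fin N → Dual k U}

/-- **The LP leaf is sound along the sorted sequence of a computation's own first forms.** Let `β`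
have `r₀` products with first forms `a_i · c_{t i}`, `t` monotone, and let the node be the prefix of
`t` of length `d ≤ r₀`. If the node is closed by an LP leaf, then `target ≤ r₀`. Proof: for each row
`j`, restricting along `S_{F_j} ≤ S` and dropping every product killed by `F_j` gives
`LB F_j ≤ (d - k_j) + #{i ≥ d | t i survives F_j}`; weight by `y_j`, sum, exchange the sums over
`j` and over the products `i ≥ d`, and use dual feasibility at the candidate `t i ≥ t p`.
[cite: Wang2026, Lemma 3 and §6–§7 (soundness of backtracking)] -/
theorem le_of_lpLeafOK_prefix
    (hLB : ∀ F r, BilinComp (φ.comp (constrSubF K c F).subtype) (Fin r) → LB F ≤ r)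
    (hkill : ∀ F n, killB F n = true → ∀ u : U, u ∈ constrSubF K c F → c n u = 0)
    {r₀ : ℕ} (β : BilinComp (φ.comp (constrSub K).subtype) (Fin r₀))
    (t : Fin r₀ → Fin N) (ht : Monotone t) (a : Fin r₀ → k)
    (hf : ∀ i (u : constrSub K), β.f i u = a i * c (t i) u)
    (d : ℕ) (hd : d ≤ r₀) (h : LPLeafOK killB LB target d (fun p => t (Fin.castLE hd p))) :
    target ≤ r₀ := by
  classical
  obtain ⟨L, Fs, ys, D, hdual, hclose⟩ := h
  -- per row: the substitution inequality with prefix/suffix bookkeeping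
  have hrow : ∀ j : Fin L,
      LB (Fs j) + (Finset.univ.filter fun p : Fin d => killB (Fs j) (t (Fin.castLE hd p)) = true).card
        ≤ d + (Finset.univ.filter fun i : Fin r₀ => d ≤ i.val ∧ killB (Fs j) (t i) = false).card := by
    intro j
    set F := Fs j with hFdef
    -- killed products in the prefix and in the suffix
    let Jpre : Finset (Fin r₀) :=
      ((Finset.univ : Finset (Fin d)).filter fun p => killB F (t (Fin.castLE hd p)) = true).map
        (Fin.castLEEmb hd)
    let Jsuf : Finset (Fin r₀) := Finset.univ.filter fun i => d ≤ i.val ∧ killB F (t i) = true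
    have hpre_card : Jpre.card =
        (Finset.univ.filter fun p : Fin d => killB F (t (Fin.castLE hd p)) = true).card :=
      Finset.card_map _
    have hdisj : Disjoint Jpre Jsuf := by
      rw [Finset.disjoint_left]
      intro i hi hi'
      obtain ⟨p, _, rfl⟩ := Finset.mem_map.1 hi
      have h2 := (Finset.mem_filter.1 hi').2.1
      simp [Fin.castLEEmb_apply] at h2
      exact absurd p.2 (by omega)
    let J := Jpre ∪ Jsuf
    have hJcard : J.card = Jpre.card + Jsuf.card := Finset.card_union_of_disjoint hdisj
    have hJ : ∀ i ∈ J, ∀ u : ↥(constrSubF K c F),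
        β.f i (Submodule.inclusion (constrSubF_le K c F) u) = 0 := by
      intro i hi u
      have hki : killB F (t i) = true := by
        rcases Finset.mem_union.1 hi with hi | hi
        · obtain ⟨p, hp, rfl⟩ := Finset.mem_map.1 hi
          simpa [Fin.castLEEmb_apply] using (Finset.mem_filter.1 hp).2
        · exact (Finset.mem_filter.1 hi).2.2
      rw [hf]
      have hu : c (t i) (u : U) = 0 := hkill F (t i) hki u u.2
      simp [Submodule.coe_inclusion, hu]
    obtain ⟨β'⟩ := β.exists_restrictAlong (constrSubF_le K c F) J hJ
    have h1 := hLB F _ β'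
    simp only [Fintype.card_fin] at h1
    -- the suffix splits into killed and surviving products
    let surv : Finset (Fin r₀) := Finset.univ.filter fun i => d ≤ i.val ∧ killB F (t i) = false
    have hdisj2 : Disjoint Jsuf surv := by
      rw [Finset.disjoint_left]
      intro i hi hi'
      have h1 := (Finset.mem_filter.1 hi).2.2
      have h2 := (Finset.mem_filter.1 hi').2.2
      rw [h1] at h2
      exact Bool.noConfusion h2
    have hsplit : Jsuf.card + surv.card = r₀ - d := by
      rw [← Finset.card_union_of_disjoint hdisj2, ← lpAux_card_filter_ge hd]
      congr 1
      ext i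
      simp only [Jsuf, surv, Finset.mem_union, Finset.mem_filter, Finset.mem_univ, true_and]
      cases killB F (t i) <;> simp
    have h2 : J.card ≤ r₀ := by simpa using Finset.card_le_univ J
    have hpre_le : Jpre.card ≤ d := by
      rw [hpre_card]
      exact (Finset.card_filter_le _ _).trans (by simp)
    rw [← hpre_card]
    show LB F + Jpre.card ≤ d + surv.card
    omega
  -- weighted sum of the rows
  have hsum : ∑ j, ys j * (LB (Fs j) +
        (Finset.univ.filter fun p : Fin d => killB (Fs j) (t (Fin.castLE hd p)) = true).card)
      ≤ d * ∑ j, ys j +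
        ∑ j, ys j * (Finset.univ.filter fun i : Fin r₀ => d ≤ i.val ∧ killB (Fs j) (t i) = false).card := by
    rw [Finset.mul_sum, ← Finset.sum_add_distrib]
    refine Finset.sum_le_sum fun j _ => ?_
    have := Nat.mul_le_mul_left (ys j) (hrow j)
    rw [Nat.mul_add] at this
    linarith
  -- exchange the sums: every suffix product contributes at most `D`
  have hex : ∑ j, ys j *
        (Finset.univ.filter fun i : Fin r₀ => d ≤ i.val ∧ killB (Fs j) (t i) = false).card
      ≤ D * (r₀ - d) := by
    have hrw : ∀ j ∈ (Finset.univ : Finset (Fin L)), ys j *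
        (Finset.univ.filter fun i : Fin r₀ => d ≤ i.val ∧ killB (Fs j) (t i) = false).card =
        ∑ i : Fin r₀, if d ≤ i.val ∧ killB (Fs j) (t i) = false then ys j else 0 := by
      intro j _
      rw [← Finset.sum_filter, Finset.sum_const, smul_eq_mul, Nat.mul_comm]
    rw [Finset.sum_congr rfl hrw, Finset.sum_comm]
    -- inner sums
    have hi : ∀ i : Fin r₀,
        (∑ j : Fin L, if d ≤ i.val ∧ killB (Fs j) (t i) = false then ys j else 0)
          ≤ if d ≤ i.val then D else 0 := by
      intro i
      by_cases hdi : d ≤ i.val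
      · simp only [hdi, true_and, if_true]
        rw [← Finset.sum_filter]
        refine hdual (t i) fun p => ht ?_
        simp only [Fin.le_def, Fin.val_castLE]
        exact le_trans (le_of_lt p.2) hdi
      · simp [hdi]
    refine (Finset.sum_le_sum fun i _ => hi i).trans ?_
    rw [← Finset.sum_filter, Finset.sum_const, smul_eq_mul, Nat.mul_comm]
    exact Nat.mul_le_mul_left D (lpAux_card_filter_ge hd).le
  -- conclude: `(target - 1)·D < D·r₀`
  have hfin : (target - 1) * D < D * r₀ := by
    have h3 : D * (r₀ - d) + D * d = D * r₀ := by
      rw [← Nat.mul_add, Nat.sub_add_cancel hd]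
    nlinarith [hclose, hsum, hex, h3]
  rcases Nat.eq_zero_or_pos D with hD | hD
  · subst hD; simp at hfin
  · have : target - 1 < r₀ := by
      rw [Nat.mul_comm] at hfin
      exact Nat.lt_of_mul_lt_mul_left hfin
    omega

/-- The induction behind soundness, with LP leaves (cf. `le_of_nodeOK_prefix`).
[cite: Wang2026, §6–§7 (soundness of backtracking)] -/
theorem le_of_nodeOKLP_prefix
    (hLB : ∀ F r, BilinComp (φ.comp (constrSubF K c F).subtype) (Fin r) → LB F ≤ r)
    (hkill : ∀ F n, killB F n = true → ∀ u : U, u ∈ constrSubF K c F → c n u = 0)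
    {r₀ : ℕ} (β : BilinComp (φ.comp (constrSub K).subtype) (Fin r₀))
    (t : Fin r₀ → Fin N) (ht : Monotone t) (a : Fin r₀ → k)
    (hf : ∀ i (u : constrSub K), β.f i u = a i * c (t i) u) (hdepth : maxDepth ≤ r₀) :
    ∀ fuel d (hd : d ≤ r₀), 0 < d →
      NodeOKLP killB LB target maxDepth fuel d (fun p => t (Fin.castLE hd p)) → target ≤ r₀ := by
  classical
  intro fuel
  induction fuel with
  | zero =>
    intro d hd _ h
    exact le_of_lpLeafOK_prefix hLB hkill β t ht a hf d hd h
  | succ fuel ih =>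
    intro d hd hd0 h
    rcases h with h | ⟨hdm, hch⟩
    · exact le_of_lpLeafOK_prefix hLB hkill β t ht a hf d hd h
    · -- internal node: the `(d+1)`-st product exists since `d < maxDepth ≤ r₀`
      have hd1 : d + 1 ≤ r₀ := by omega
      have hm : ∀ p : Fin d, t (Fin.castLE hd p) ≤ t ⟨d, by omega⟩ :=
        fun p => ht (by simp [Fin.le_def])
      have hchild := hch (t ⟨d, by omega⟩) hm
      have e : (Fin.snoc (fun p : Fin d => t (Fin.castLE hd p)) (t ⟨d, by omega⟩) :
          Fin (d + 1) → Fin N) = fun p => t (Fin.castLE hd1 p) := by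
        funext p
        refine Fin.lastCases ?_ (fun q => ?_) p
        · simp only [Fin.snoc_last]
          congr 1
        · simp only [Fin.snoc_castSucc]
          congr 1
      rw [e] at hchild
      exact ih (d + 1) hd1 (Nat.succ_pos d) hchild

/-- **Soundness of substitution with backtracking and LP leaves.** Same hypotheses as
`le_card_of_nodeOK_root` plus the soundness of `killB`; conclusion: every computation of
`φ|_{S × V}` has at least `target` products. [cite: Wang2026, §6–§7 (substitution with backtracking; soundness)] -/
theorem le_card_of_nodeOKLP_root
    (hLB : ∀ F r, BilinComp (φ.comp (constrSubF K c F).subtype) (Fin r) → LB F ≤ r)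
    (hkill : ∀ F n, killB F n = true → ∀ u : U, u ∈ constrSubF K c F → c n u = 0)
    (hcov : ∀ f : Dual k (constrSub K), f ≠ 0 →
      ∃ n, ∃ a : k, a ≠ 0 ∧ ∀ u, f u = a * c n u)
    (hφ : φ.comp (constrSub K).subtype ≠ 0)
    (hdepth : ∀ r, BilinComp (φ.comp (constrSub K).subtype) (Fin r) → maxDepth ≤ r)
    (fuel : ℕ) (hroot : ∀ m : Fin N, NodeOKLP killB LB target maxDepth fuel 1 (fun _ => m))
    {ι : Type*} [Fintype ι] (β : BilinComp (φ.comp (constrSub K).subtype) ι) :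
    target ≤ Fintype.card ι := by
  classical
  obtain ⟨r₀, hr₀, β₀, hnz⟩ := β.exists_forall_f_ne_zero
  refine le_trans ?_ hr₀
  choose n a ha hfa using fun i => hcov (β₀.f i) (hnz i)
  let σ := Tuple.sort n
  have ht : Monotone (n ∘ σ) := Tuple.monotone_sort n
  let β₁ := β₀.reindex σ
  have hf : ∀ i (u : constrSub K), β₁.f i u = (a ∘ σ) i * c ((n ∘ σ) i) u := fun i u =>
    hfa (σ i) u
  have hpos : 0 < r₀ := by
    obtain ⟨i, _⟩ := exists_f_ne_zero β₀ hφ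
    exact Fin.pos i
  have h1 : (1 : ℕ) ≤ r₀ := hpos
  have e : (fun p : Fin 1 => (n ∘ σ) (Fin.castLE h1 p)) = fun _ => (n ∘ σ) ⟨0, hpos⟩ := by
    funext p
    have : p = 0 := Subsingleton.elim _ _
    subst this
    rfl
  have := hroot ((n ∘ σ) ⟨0, hpos⟩)
  rw [← e] at this
  exact le_of_nodeOKLP_prefix hLB hkill β₁ (n ∘ σ) ht (a ∘ σ) hf (hdepth r₀ β₀) fuel 1 h1
    Nat.one_pos this

/-! ### Certificates replayed by `decide` -/

/-- **LP backtracking certificate**: a tree whose leaves carry LP rows `(F_j, y_j)` and a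
denominator `D`, and whose internal nodes carry one child per candidate index.
[cite: Wang2026, §7 (Backtracking certificates)] -/
inductive LPCert (N : ℕ) : Type
  | leaf (rows : List (Finset (Fin N) × ℕ)) (D : ℕ) : LPCert N
  | node (cs : Fin N → LPCert N) : LPCert N

/-- A fuel bound for a certificate (its height). [cite: Wang2026, §7 (Backtracking)] -/
def LPCert.height : LPCert N → ℕ
  | .leaf _ _ => 0
  | .node cs => (Finset.univ.sup fun m => (cs m).height) + 1

variable (killB LB target maxDepth)

/-- The Boolean test of an LP leaf with rows `rows` and denominator `D` at node `s`.
[cite: Wang2026, §7 (Backtracking certificates)] -/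
def lpLeafB (rows : List (Finset (Fin N) × ℕ)) (D : ℕ) (d : ℕ) (s : Fin d → Fin N) : Bool :=
  decide (∀ n : Fin N, (∀ p : Fin d, s p ≤ n) →
      ∑ j ∈ Finset.univ.filter (fun j : Fin rows.length => killB (rows.get j).1 n = false),
        (rows.get j).2 ≤ D) &&
  decide ((target - 1) * D + d * ∑ j : Fin rows.length, (rows.get j).2 <
      ∑ j : Fin rows.length, (rows.get j).2 * (LB (rows.get j).1 +
        (Finset.univ.filter fun p => killB (rows.get j).1 (s p) = true).card) + D * d)

/-- **The replay check with LP leaves**: a leaf is accepted iff `lpLeafB`; a node iff `d < maxDepth`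
and every child `m` above all entries of `s` is accepted at depth `d + 1`.
[cite: Wang2026, §7 (Backtracking certificates; replay)] -/
def LPCert.check : LPCert N → (d : ℕ) → (Fin d → Fin N) → Bool
  | .leaf rows D, d, s => lpLeafB killB LB target rows D d s
  | .node cs, d, s => decide (d < maxDepth) &&
      decide (∀ m : Fin N, (∀ p : Fin d, s p ≤ m) → (cs m).check (d + 1) (Fin.snoc s m) = true)

variable {killB LB target maxDepth}

/-- An accepted LP leaf is an `LPLeafOK`. [cite: Wang2026, §7 (Backtracking certificates)] -/
theorem lpLeafOK_of_lpLeafB {rows : List (Finset (Fin N) × ℕ)} {D d : ℕ} {s : Fin d → Fin N}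
    (h : lpLeafB killB LB target rows D d s = true) : LPLeafOK killB LB target d s := by
  simp only [lpLeafB, Bool.and_eq_true, decide_eq_true_eq] at h
  exact ⟨rows.length, fun j => (rows.get j).1, fun j => (rows.get j).2, D, h.1, h.2⟩

/-- `NodeOKLP` is monotone in the fuel. [cite: Wang2026, §6 (substitution with backtracking)] -/
theorem NodeOKLP.mono {fuel fuel' : ℕ} (h : fuel ≤ fuel') {d : ℕ} {s : Fin d → Fin N}
    (hn : NodeOKLP killB LB target maxDepth fuel d s) :
    NodeOKLP killB LB target maxDepth fuel' d s := by
  induction fuel' generalizing fuel d with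
  | zero =>
    have : fuel = 0 := Nat.le_zero.1 h
    subst this
    exact hn
  | succ fuel' ih =>
    rcases Nat.eq_zero_or_pos fuel with rfl | hpos
    · exact Or.inl hn
    · obtain ⟨f, rfl⟩ : ∃ f, fuel = f + 1 := ⟨fuel - 1, by omega⟩
      rcases hn with hl | ⟨hd, hch⟩
      · exact Or.inl hl
      · exact Or.inr ⟨hd, fun m hm => ih (by omega) (hch m hm)⟩

/-- **Soundness of the replay**: an accepted LP certificate establishes `NodeOKLP` (with fuel its
height). [cite: Wang2026, §7 (Backtracking certificates; replay)] -/
theorem LPCert.nodeOKLP_of_check : ∀ (t : LPCert N) (d : ℕ) (s : Fin d → Fin N),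
    t.check killB LB target maxDepth d s = true → NodeOKLP killB LB target maxDepth t.height d s
  | .leaf rows D, d, s, h => by
    have hl : LPLeafOK killB LB target d s := lpLeafOK_of_lpLeafB (by simpa [LPCert.check] using h)
    simp only [LPCert.height]
    exact hl
  | .node cs, d, s, h => by
    simp only [LPCert.check, Bool.and_eq_true, decide_eq_true_eq] at h
    obtain ⟨hd, hch⟩ := h
    simp only [LPCert.height]
    refine Or.inr ⟨hd, fun m hm => ?_⟩
    have ih := LPCert.nodeOKLP_of_check (cs m) (d + 1) (Fin.snoc s m) (hch m hm)
    exact ih.mono (Finset.le_sup (f := fun m => (cs m).height) (Finset.mem_univ m))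

/-- **Replay form of the soundness theorem with LP leaves**: a root family of accepted LP
certificates proves `target ≤` the length of every computation of `φ|_{S × V}`.
[cite: Wang2026, §6–§7 (substitution with backtracking; verification)] -/
theorem le_card_of_checkLP_root
    (hLB : ∀ F r, BilinComp (φ.comp (constrSubF K c F).subtype) (Fin r) → LB F ≤ r)
    (hkill : ∀ F n, killB F n = true → ∀ u : U, u ∈ constrSubF K c F → c n u = 0)
    (hcov : ∀ f : Dual k (constrSub K), f ≠ 0 →
      ∃ n, ∃ a : k, a ≠ 0 ∧ ∀ u, f u = a * c n u)
    (hφ : φ.comp (constrSub K).subtype ≠ 0)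
    (hdepth : ∀ r, BilinComp (φ.comp (constrSub K).subtype) (Fin r) → maxDepth ≤ r)
    (root : Fin N → LPCert N)
    (hroot : ∀ m : Fin N, (root m).check killB LB target maxDepth 1 (fun _ => m) = true)
    {ι : Type*} [Fintype ι] (β : BilinComp (φ.comp (constrSub K).subtype) ι) :
    target ≤ Fintype.card ι := by
  classical
  refine le_card_of_nodeOKLP_root hLB hkill hcov hφ hdepth
    (Finset.univ.sup fun m => (root m).height) (fun m => ?_) β
  exact (LPCert.nodeOKLP_of_check (root m) 1 _ (hroot m)).mono
    (Finset.le_sup (f := fun m => (root m).height) (Finset.mem_univ m))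

/-! ### An LP leaf at the root (the plain LP certificate of an orbit)

Wang's degenerate reduction and the Hopcroft–Kerr substitution at the root are the one-row case; a
weighted family of rows at depth `0` is the "fractional substitution" certificate: no branching, no
non-vanishing or depth hypothesis, only the cover, the lookups `LB`, the soundness of `killB`, dual
feasibility for every candidate and one inequality in `ℕ`. -/

/-- **An LP leaf at depth `0` is a certificate by itself**: if `LPLeafOK` holds at the root (empty
prefix) then every computation of `φ|_{S × V}` has at least `target` products (the case `d = 0` of
the prefix lemma, after sorting the products by their covering candidates).
[cite: Wang2026, Lemma 3 and §7 (certificates)] -/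
theorem le_card_of_lpLeafOK_zero
    (hLB : ∀ F r, BilinComp (φ.comp (constrSubF K c F).subtype) (Fin r) → LB F ≤ r)
    (hkill : ∀ F n, killB F n = true → ∀ u : U, u ∈ constrSubF K c F → c n u = 0)
    (hcov : ∀ f : Dual k (constrSub K), f ≠ 0 →
      ∃ n, ∃ a : k, a ≠ 0 ∧ ∀ u, f u = a * c n u)
    (h : ∀ s : Fin 0 → Fin N, LPLeafOK killB LB target 0 s)
    {ι : Type*} [Fintype ι] (β : BilinComp (φ.comp (constrSub K).subtype) ι) :
    target ≤ Fintype.card ι := by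
  classical
  obtain ⟨r₀, hr₀, β₀, hnz⟩ := β.exists_forall_f_ne_zero
  refine le_trans ?_ hr₀
  choose n a ha hfa using fun i => hcov (β₀.f i) (hnz i)
  let σ := Tuple.sort n
  have ht : Monotone (n ∘ σ) := Tuple.monotone_sort n
  let β₁ := β₀.reindex σ
  have hf : ∀ i (u : constrSub K), β₁.f i u = (a ∘ σ) i * c ((n ∘ σ) i) u := fun i u =>
    hfa (σ i) u
  exact le_of_lpLeafOK_prefix hLB hkill β₁ (n ∘ σ) ht (a ∘ σ) hf 0 (Nat.zero_le _) (h _)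

/-- **Replay form at depth `0`**: an accepted LP leaf `lpLeafB … rows D 0 s` (any, equivalently
every, empty prefix `s`) proves `target ≤` the length of every computation of `φ|_{S × V}`.
[cite: Wang2026, Lemma 3 and §7 (certificates; replay)] -/
theorem le_card_of_lpLeafB_zero
    (hLB : ∀ F r, BilinComp (φ.comp (constrSubF K c F).subtype) (Fin r) → LB F ≤ r)
    (hkill : ∀ F n, killB F n = true → ∀ u : U, u ∈ constrSubF K c F → c n u = 0)
    (hcov : ∀ f : Dual k (constrSub K), f ≠ 0 →
      ∃ n, ∃ a : k, a ≠ 0 ∧ ∀ u, f u = a * c n u)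
    {rows : List (Finset (Fin N) × ℕ)} {D : ℕ}
    (h : lpLeafB killB LB target rows D 0 Fin.elim0 = true)
    {ι : Type*} [Fintype ι] (β : BilinComp (φ.comp (constrSub K).subtype) ι) :
    target ≤ Fintype.card ι := by
  refine le_card_of_lpLeafOK_zero hLB hkill hcov (fun s => ?_) β
  have hs : s = Fin.elim0 := funext fun p => Fin.elim0 p
  rw [hs]
  exact lpLeafOK_of_lpLeafB h

/-- The membership instance of `killB` is always sound: a candidate listed in `F` vanishes on `S_F`.
[cite: Wang2026, §7 (certificates)] -/
theorem killB_mem_sound (F : Finset (Fin N)) (n : Fin N) (hn : decide (n ∈ F) = true) (u : U)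
    (hu : u ∈ constrSubF K c F) : c n u = 0 :=
  (mem_constrSubF.1 hu).2 n (of_decide_eq_true hn)

end LPBacktracking

end Literature.Computability.AlgebraicComplexity
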